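import Summits.QuantumFields.BalabanUV.Beta.FP.NestedDoorSocketTowerG
import Summits.QuantumFields.BalabanUV.Beta.FP.PackedLawFullIndex
import Summits.QuantumFields.BalabanUV.Beta.FP.KktUnitConjugation
import Summits.QuantumFields.BalabanUV.Beta.FP.NestedDeadRowsOrderTwoTowerClosedG

/-!
# `BalabanUV.Beta.FP.TowerLawFullIndexG` — road «FP» for binder row D1, ROUTE T under RULING R-D1-g52-1 (β1) ∕ R-FP-69 ∕ R-FP-70: **THE `-G` EDITION OF #41d
# `TowerLawFullIndex`** — THE TOWER's (T-ID) LAW ON THE FIBRED TORUS INDICES, GENERIC over leaf-06 G-0's step-row family `Q : StepRows d Lc` and the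
# form-kernel family `K : ℕ → (Fin (d+1) → ℕ) → MKer (d+1) (Fib d)`: the adapter #41c-G `NestedDoorSocketTowerG.hessT_kernel_law_tower_G` (#21-G BY TERM per
# direction through the socket #41a) COMPOSED WITH the assembly socket #39 `PackedLawFullIndex.hessT_fullIndex_law_of_packed_law` (S3-3), with ALL THREE
# (S3-1) legs DISPLAYED — in particular the TOP-COMB leg, which #41d discharged inside by the ROOTED #41b `PackedLegCombRooted` at the chart
# `Π̂ᵀ(KInvStep Lc (lev 0))Π̂ @ rs 0`, is here a HYPOTHESIS over an ABSTRACT chart kernel `A_G` (right inverse `X_G` of the UNSCALED top form's comb-KKT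
# `kkt 𝓚(M′, lev 0, rs 0)|ff [Q₂₀; τ₂]`, its packed leg `hLG`, `A_G`'s torus rules `hEAG hAEG`, the packing injection `f_G` with `hfG hmG hcG`); the unit
# identity `S₁₁ = (∏ wVH)⁻¹ • 𝓚(M′, lev 0, rs 0)|ff` that #41d took from leaf-06's rooted `torus_kkt_nondeg_tower` .2.2 comes from leaf-06 g32's GENERIC G-5
# `NestedDeadRowsOrderTwoTowerClosedG.torus_kkt_nondeg_towerG` .2.2 fed by leaf-05 g40's `TorusEffFormCompositeG.torus_composite_inv_and_eff_G` (the displayed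
# one-step letters `hone hId`), the displayed `a0 ∕ hH₀t ∕ c0 ∕ hSL` and `htop` (v1.1, R-FP-71 «display what you use»: #41c-G v1.1's single-instance rows
# `hSL c0 hTW` replace v1's universal covariance family `hc0` — unsatisfiable at the (0.4)-sym kernel off the centred root list, leaf-02 g31 W-1 l.56632):
# `hessT (perF T A_N) V_N V′_N W_N = hessT (perF T A_F) V_F V′_F W_F + hessT (perF M′ A_G) V_G V′_G W_G`, `T = towerTorus Lc M′ (n+1)`.

WHAT IS DISPLAYED.  #41c-G's binders VERBATIM (the generic pins `hH₀ hQ₁₀ hτ₁` over `(Q, K)`, the brick inputs `hH₀t hone hId hSL c0 hTW`, `hτ₂ : τ₂ = combF …`,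
the top rows `Q₂₀` ABSTRACT with `htop`, `hW₀ hP c hDbar hΓ hI hL hS h𝔔₀`, the direction module `V` with `hv lv hlv Xbf hXbf`, the jets ∕ namings ∕ generator
jets as functions, #21's rows `uTop hH₁t hH₂t a0 d0 a1 a2 c1 c2 d1 d2`) EXCEPT the right inverse `XG` of #21-G's coarse system `kkt S₁₁ [Q₂₀; τ₂]`, which is
CONSTRUCTED from the displayed `X_G` exactly as in #41d: `D(1, w⁻¹) · X_G · D(w, 1)`, `w := ∏_{i<n+1} wVH d Lc (lev i)` (#40a `kkt_inv_smul_mul_rightInverse`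
(U2) after `S₁₁ = w⁻¹ • 𝓚(M′, lev 0, rs 0)|ff`); PLUS, DISPLAYED: (S3-1) for N, F (#41d VERBATIM) AND G (new), (S3-2) for N ∕ F ∕ G (#41d VERBATIM but for the
abstract `f_G` in place of #21's slot map; G's H-blocks carry `w •`).  CONCLUSION: `hessT (perF T A_N) V_N V′_N W_N = hessT (perF T A_F) V_F V′_F W_F + hessT
(perF M′ A_G) V_G V′_G W_G`.  Proof = #41d's lines with the three rooted fetches replaced: `hS₁₁` by G-5 .2.2 (its `hInv ∕ hEff` = leaf-05's
`torus_composite_inv_and_eff_G … hone hId` rewritten at `hH₀ hQ₁₀`, `h2F` = `htop`, `a0 ∕ c0` at `hW₀`, `hSL` as displayed — the road's R-FP-71 call shape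
`torus_kkt_nondeg_towerG … Q hrs H₀ hτ₁ τ₂ Q₂₀ D₀ c0 hSL a0 hH₀t hInv hc hEff h2F`), `hX₁ ∕ hLG` by the displayed `hXG ∕ hLG`, G's torus rules by the displayed `hEAG hAEG`; then #41c-G at the constructed inverse,
the G leg rewritten by #40a (U3)(U5), ONE term of #39.  INSTANCES (not re-stated here; R-FP-70): ROOTED (`Q := Qstep`, `K := bhKStepAt`, the G leg by #41b,
`f_G` = the slot map, `(ρ_G, L_G, A_G) = (toSite (rs 0), Lc, coDressKBmAt (toSite (rs 0)) Lc (KInvStep Lc (lev 0)))`) IS #41d `hessT_fullIndex_law_tower`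
(p367288 ✓); SYM (`Q := QSym Lc`, `K ℓ _ := bhKStepSh d Lc (Dsh Lc) ℓ`, `rs := fun _ => ctrOff (d+1) Lc`) takes leaf-05's sym comb leg for (S3-1) G and the
row's sym one-shot charts for N ∕ F.  [folklore] composition BY NAME; no `def`, no `def … : Prop`, nothing cited, 0 sorry.  The rows, the three legs, the
namings and the brick inputs are HYPOTHESES (nothing of the dictionary ∕ Bałaban's asserted; the presentation is the ROW's (β1) ruling).  NOT HERE:
de-periodisation ((P2‴) — #42a-G), the identifications (L2′), the END (#42b §3).

HONEST DEPENDENCY (page 1, mandatory): continuum YM on T⁴ ⇐ BetaPertH ∧ nine spine estimates (0/9 proved); BetaPertH ⇐ (D1) ∧ (D4) ∧ CAP+tail;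
G-an2-4 gates asym, D1 and NE2/3/4.  HONEST FRAMING (cell contract, verbatim): «discharging `BetaPertH` makes Bałaban's UV stability UNCONDITIONAL —
a real constructive-QFT result; it is NOT the continuum limit and NOT the Clay problem.»  ABSOLUTE RULE (cell charter, verbatim): «No internally-minted
statement may enter as a cited fact. Every hypothesis is either kernel-proved in this package or a verbatim quotation of a PUBLISHED theorem with page
reference. The manuscript(s) under audit are NOT citable for their own disputed steps — they are the thing under adjudication; programme-internal
(2001/route/tribunal) claims are never citable.»  0 estimates; 0∕4 row-D1 binders (hW, hR, D1Tel, D1Rep — `D1Tel` CONCLUDED only from displayed rows);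
NOT (C1), NOT (L2′), NOT (T-ID) complete, NOT SDF, NOT D1, NOT BetaPertH, NOT continuum, NOT Clay.  Road «FP» OWNER, b2b-balaban-beta-d1-p3 gen 30 (v1) ∕
gen 31 (v1.1, R-FP-71), 2026-08-24.  No existing file touched.
-/

noncomputable section

open scoped BigOperators Matrix

namespace Summit.QuantumFields.BalabanUV.Beta.FP.TowerLawFullIndexG

open Matrix Finset
open Literature.Probability.LatticeModels (Torus.proj)
open Literature.MathematicalPhysics.QuantumFieldTheory.Balaban1983to89
open Literature.MathematicalPhysics.QuantumFieldTheory.Balaban1983to89.Beta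
open Literature.MathematicalPhysics.QuantumFieldTheory.Balaban1983to89.Beta.Composition (kkt)
open Literature.MathematicalPhysics.QuantumFieldTheory.Balaban1983to89.Beta.CompositionSingular (effForm flucCov minOp minOpL)
open B5Prop11Plancherel (fine)
open B6Lemma24Torus (pbox mem_pbox)
open AffineAveraging (Site box toSite unitVec)
open OneStepResolventKernel (Fib)
open OneStepKernelFamily (KInvStep)
open ExpKernelCalculus (MKer)
open BalabanStepJetsSucc (wVH)
open Summit.QuantumFields.BalabanUV.Beta.AxialDressingRooted (axEc coDressKBmAt)
open Summit.QuantumFields.BalabanUV.Beta.BorderedHessian (bhKStepAt stepScale)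
open Summit.QuantumFields.BalabanUV.Beta.D1BFx.LogDetSecondVariation (secondVar)
open Summit.QuantumFields.BalabanUV.Beta.D1BFx.MixedVarPackedHess (hessT)
open Summit.QuantumFields.BalabanUV.Beta.FP.KernelPeriodisationFib (Idx perF)
open Summit.QuantumFields.BalabanUV.Beta.FP.TorusCombRows (Res combRowsT)
open Summit.QuantumFields.BalabanUV.Beta.FP.TorusCompositeObjects (towerTorus compRows NParam combF bigP towerGen)
open Summit.QuantumFields.BalabanUV.Beta.FP.TorusCompositeObjectsG (StepRows compRowsG nestedSliceG)
open Summit.QuantumFields.BalabanUV.Beta.FP.TorusCompositeFP (evalN)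
open Summit.QuantumFields.BalabanUV.Beta.FP.TorusGaugeCovariance (tgrad)
open Summit.QuantumFields.BalabanUV.Beta.GAN24.FineReadoutCauchyFrame (toSite_mem_range)
open Summit.QuantumFields.BalabanUV.Beta.FP.RelInvPeriodisedEffFormCoarse (wVH_pos)
open Summit.QuantumFields.BalabanUV.Beta.FP.TorusCompositeSlice (prod_stepScale_mul_card_ne_zero)
open Summit.QuantumFields.BalabanUV.Beta.FP.TorusEffFormCompositeG (torus_composite_inv_and_eff_G)
open Summit.QuantumFields.BalabanUV.Beta.FP.KktUnitConjugation (kkt_inv_smul_mul_rightInverse fromBlocks_one_units_eq_diagonal fromBlocks_units_one_eq_diagonal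
  submatrix_diagonal_mul_mul_diagonal sumElim_const_comp_map hessT_unitConj)
open Summit.QuantumFields.BalabanUV.Beta.FP.PackedLawFullIndex (hessT_fullIndex_law_of_packed_law)
open Summit.QuantumFields.BalabanUV.Beta.FP.NestedDeadRowsOrderTwoTowerClosedG (torus_kkt_nondeg_towerG)
open Summit.QuantumFields.BalabanUV.Beta.FP.NestedDoorSocketTowerG (hessT_kernel_law_tower_G)

variable {d : ℕ}

section LawG

variable (M' : Fin (d + 1) → ℕ) [∀ μ, NeZero (M' μ)] (Lc : ℕ) [NeZero Lc] (lev : ℕ → ℕ) (rs : ℕ → (Fin (d + 1) → ℕ)) (n : ℕ)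

set_option synthInstance.maxSize 1024 in
set_option maxHeartbeats 1600000 in
/-- [folklore] **THE TOWER's (T-ID) LAW ON THE FIBRED TORUS INDICES, GENERIC OVER `(Q, K)`** (the `-G` edition of #41d `hessT_fullIndex_law_tower`, R-FP-70).
#41c-G `hessT_kernel_law_tower_G`'s binders VERBATIM except the right inverse of #21-G's coarse system, CONSTRUCTED here from the displayed top-comb
inverse `X_G`; PLUS, DISPLAYED: (S3-1) for N, F (#41d verbatim) AND G (new: `hXG hLG`, `f_G` with `hfG hmG hcG`, `A_G` with `hEAG hAEG`), (S3-2) for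
N ∕ F ∕ G (G's H-blocks carry `∏_{i<n+1} wVH d Lc (lev i)`) ⊢ `hessT (perF T A_N) V_N V′_N W_N = hessT (perF T A_F) V_F V′_F W_F + hessT (perF M′ A_G) V_G
V′_G W_G`.  Proof: `S₁₁ = w⁻¹ • 𝓚(M′, lev 0, rs 0)|ff` by leaf-06 G-5 `torus_kkt_nondeg_towerG` .2.2 (fed `a0 hH₀t c0 hSL`, leaf-05 `torus_composite_inv_and_eff_G
… hone hId`, `htop`); #41c-G at `D(1,w⁻¹)·X_G·D(w,1)` (#40a (U2)); the G leg by (U3)(U5) + `hLG`; ONE term of #39.  `maxHeartbeats 1600000` exactly as #41d. -/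
theorem hessT_fullIndex_law_tower_G (Q : StepRows d Lc) (K : ℕ → (Fin (d + 1) → ℕ) → MKer (d + 1) (Fib d)) (hrs : ∀ k, rs k ∈ box (d + 1) Lc) (hlev : ∀ i, lev i = lev (i + 1) + 1)
    (hM' : ∀ i, Lc ∣ M' i)
    -- the top multipliers' slot presentation (#21 VERBATIM)
    {κ : Type*} [Fintype κ] [DecidableEq κ]
    -- the composite objects PINNED over the abstract families: finest form `K (lev (n+1)) (rs (n+1))`, rows `compRowsG Lc Q`, nested slice `nestedSliceG Lc Q`
    {H₀ : Matrix (↥(pbox (towerTorus Lc M' (n + 1))) × Fin (d + 1)) (↥(pbox (towerTorus Lc M' (n + 1))) × Fin (d + 1)) ℝ}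
    {Q₁₀ : Matrix (↥(pbox M') × Fin (d + 1)) (↥(pbox (towerTorus Lc M' (n + 1))) × Fin (d + 1)) ℝ}
    {τ₁ : Matrix (NParam Lc (fine Lc M') (fun k => rs (k + 1)) n) (↥(pbox (towerTorus Lc M' (n + 1))) × Fin (d + 1)) ℝ}
    (hH₀ : H₀ = (perF (towerTorus Lc M' (n + 1)) (K (lev (n + 1)) (rs (n + 1)))).submatrix
        (fun b : (↥(pbox (towerTorus Lc M' (n + 1))) × Fin (d + 1)) => ((b.1, Sum.inl b.2) : Idx (towerTorus Lc M' (n + 1)) (Fib d)))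
        (fun b : (↥(pbox (towerTorus Lc M' (n + 1))) × Fin (d + 1)) => ((b.1, Sum.inl b.2) : Idx (towerTorus Lc M' (n + 1)) (Fib d))))
    (hQ₁₀ : Q₁₀ = compRowsG Lc Q M' lev rs (n + 1))
    (hτ₁ : τ₁ = bigP Lc (fine Lc M') (fun k => rs (k + 1)) (fun k => toSite_mem_range (hrs (k + 1))) n)
    -- DISPLAYED BRICK INPUTS (discharged per instance): the finest form block is symmetric; leaf-05's one-step letters (h1)ₖ ∕ (hId)ₖ at every storey
    (hH₀t : H₀ᵀ = H₀)
    (hone : ∀ (k : ℕ) (T : Fin (d + 1) → ℕ) [∀ μ, NeZero (T μ)],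
      (kkt ((perF (fine Lc T) (K (lev k) (rs k))).submatrix
            (fun b : ↥(pbox (fine Lc T)) × Fin (d + 1) => ((b.1, Sum.inl b.2) : Idx (fine Lc T) (Fib d)))
            (fun b : ↥(pbox (fine Lc T)) × Fin (d + 1) => ((b.1, Sum.inl b.2) : Idx (fine Lc T) (Fib d))))
        (fromRows (Q T (lev k) (rs k)) (combF Lc (fine Lc T) (rs k)))).det ≠ 0)
    (hId : ∀ (k : ℕ) (T : Fin (d + 1) → ℕ) [∀ μ, NeZero (T μ)] (r' : Fin (d + 1) → ℕ),
      (effForm ((perF (fine Lc T) (K (lev k) (rs k))).submatrix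
            (fun b : ↥(pbox (fine Lc T)) × Fin (d + 1) => ((b.1, Sum.inl b.2) : Idx (fine Lc T) (Fib d)))
            (fun b : ↥(pbox (fine Lc T)) × Fin (d + 1) => ((b.1, Sum.inl b.2) : Idx (fine Lc T) (Fib d))))
          (fromRows (Q T (lev k) (rs k)) (combF Lc (fine Lc T) (rs k)))).toBlocks₁₁
        = (wVH d Lc (lev k + 1))⁻¹ • (perF T (K (lev k + 1) r')).submatrix
            (fun b : ↥(pbox T) × Fin (d + 1) => ((b.1, Sum.inl b.2) : Idx T (Fib d)))
            (fun b : ↥(pbox T) × Fin (d + 1) => ((b.1, Sum.inl b.2) : Idx T (Fib d))))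
    -- (SLICE-m) OF THE TOWER BELOW `M′`, DISPLAYED (R-FP-71 «display what you use»): its NESTED comb slice is transversal to its generators
    -- (rooted: leaf-06 `TorusCompositeSlice.det_nestedSlice_mul_towerGen_ne_zero`; sym: leaf-06's G-1 sym theorem at the constant root list, fed leaf-02's R-20)
    (hSL : (nestedSliceG Lc Q (fine Lc M') (fun k => lev (k + 1)) (fun k => rs (k + 1)) n
        * towerGen Lc (fine Lc M') (fun k => rs (k + 1)) n).det ≠ 0)
    {τ₂ : Matrix (Res (toSite (rs 0)) Lc M') (↥(pbox M') × Fin (d + 1)) ℝ} (hτ₂ : τ₂ = combF Lc M' (rs 0))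
    (Q₂₀ : Matrix κ (↥(pbox M') × Fin (d + 1)) ℝ)
    (htop : (kkt ((perF M' (K (lev 0) (rs 0))).submatrix (fun b : ↥(pbox M') × Fin (d + 1) => ((b.1, Sum.inl b.2) : Idx M' (Fib d)))
        (fun b : ↥(pbox M') × Fin (d + 1) => ((b.1, Sum.inl b.2) : Idx M' (Fib d)))) (fromRows Q₂₀ τ₂)).det ≠ 0)
    {W₀ : Matrix (↥(pbox (towerTorus Lc M' (n + 1))) × Fin (d + 1)) (NParam Lc M' rs (n + 1)) ℝ} (hW₀ : W₀ = towerGen Lc M' rs (n + 1))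
    {P : Matrix (NParam Lc M' rs (n + 1)) (↥(pbox (towerTorus Lc M' (n + 1))) × Fin (d + 1)) ℝ} (hP : P = bigP Lc M' rs (fun k => toSite_mem_range (hrs k)) (n + 1))
    -- the step constant of the chart transport (#21's `c`), the (COV-m) order-0 image PINNED, the one-shot resolvent words and `𝔔₀` NAMED (#21 VERBATIM)
    (c : ℝ)
    {Dbar : Matrix (↥(pbox M') × Fin (d + 1)) (Res (toSite (rs 0)) Lc M') ℝ}
    (hDbar : Dbar = (∏ i ∈ range (n + 1), (stepScale d Lc (lev (i + 1)) * ((box (d + 1) Lc).card : ℝ))) •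
        (tgrad M').submatrix (fun a : (↥(pbox M') × Fin (d + 1)) => ((a.1, Sum.inl a.2) : Idx M' (Fib d))) (fun t : (Res (toSite (rs 0)) Lc M') => (t.1 : ↥(pbox M'))))
    -- (COV-m) ORDER 0 AT THE TOP DEPTH in the pinned letters and the ONE-SHOT slice's transversality, DISPLAYED (R-FP-71 «display what you use»;
    -- rooted: leaf-02 `compRows_mul_towerGen_succ` ∕ leaf-06 `torus_hTW_oneShot_tower`; sym: leaf-02's R-20 at the constant root list ∕ leaf-06 G-2 §2)
    (c0 : Q₁₀ * W₀ = fromCols Dbar (0 : Matrix (↥(pbox M') × Fin (d + 1)) (NParam Lc (fine Lc M') (fun k => rs (k + 1)) n) ℝ))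
    (hTW : (Matrix.fromRows (τ₂ * Q₁₀) τ₁ * W₀).det ≠ 0)
    {Γ : Matrix (↥(pbox (towerTorus Lc M' (n + 1))) × Fin (d + 1)) (↥(pbox (towerTorus Lc M' (n + 1))) × Fin (d + 1)) ℝ} {I : Matrix (↥(pbox (towerTorus Lc M' (n + 1))) × Fin (d + 1)) ((↥(pbox M') × Fin (d + 1)) ⊕ (NParam Lc (fine Lc M') (fun k => rs (k + 1)) n)) ℝ} {L : Matrix ((↥(pbox M') × Fin (d + 1)) ⊕ (NParam Lc (fine Lc M') (fun k => rs (k + 1)) n)) (↥(pbox (towerTorus Lc M' (n + 1))) × Fin (d + 1)) ℝ} {S : Matrix ((↥(pbox M') × Fin (d + 1)) ⊕ (NParam Lc (fine Lc M') (fun k => rs (k + 1)) n)) ((↥(pbox M') × Fin (d + 1)) ⊕ (NParam Lc (fine Lc M') (fun k => rs (k + 1)) n)) ℝ}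
    (hΓ : flucCov H₀ (fromRows Q₁₀ τ₁) = Γ) (hI : minOp H₀ (fromRows Q₁₀ τ₁) = I) (hL : minOpL H₀ (fromRows Q₁₀ τ₁) = L) (hS : effForm H₀ (fromRows Q₁₀ τ₁) = S)
    {𝔔₀ : Matrix κ (↥(pbox (towerTorus Lc M' (n + 1))) × Fin (d + 1)) ℝ} (h𝔔₀ : Q₂₀ * Q₁₀ = 𝔔₀)
    -- the direction module and its DISPLAYED read-outs: finest-level direction `h := hv v` (enters only the rows and the generator jets — no linearity
    -- needed here: the jets' (bi)linearity is displayed; at the record it follows from `hv`'s), tree-gauge parameter `λ := lv v` and top generator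
    -- `X̄ := Xbf v` (LINEAR: they enter the one-shot namings `k1 k2 q1 q2`)
    {V : Type*} [AddCommGroup V] [Module ℝ V]
    (hv : V → ((↥(pbox (towerTorus Lc M' (n + 1))) × Fin (d + 1)) → ℝ)) (lv : V → (↥(pbox (towerTorus Lc M' (n + 1))) → ℝ))
    (hlv : ∀ (r : ℝ) (x y : V), lv (r • x + y) = r • lv x + lv y)
    (Xbf : V → Matrix κ κ ℝ) (hXbf : ∀ (r : ℝ) (x y : V), Xbf (r • x + y) = r • Xbf x + Xbf y)
    -- #21's displayed jets AS FUNCTIONS of the direction: first order linear, second order in two slots (linear in each; the door reads the diagonal)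
    (H₁f : V → Matrix (↥(pbox (towerTorus Lc M' (n + 1))) × Fin (d + 1)) (↥(pbox (towerTorus Lc M' (n + 1))) × Fin (d + 1)) ℝ) (hH₁l : ∀ (r : ℝ) (x y : V), H₁f (r • x + y) = r • H₁f x + H₁f y)
    (Q₁₁f : V → Matrix (↥(pbox M') × Fin (d + 1)) (↥(pbox (towerTorus Lc M' (n + 1))) × Fin (d + 1)) ℝ) (hQ₁₁l : ∀ (r : ℝ) (x y : V), Q₁₁f (r • x + y) = r • Q₁₁f x + Q₁₁f y)
    (Q₂₁f : V → Matrix κ (↥(pbox M') × Fin (d + 1)) ℝ) (hQ₂₁l : ∀ (r : ℝ) (x y : V), Q₂₁f (r • x + y) = r • Q₂₁f x + Q₂₁f y)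
    (H₂f : V → V → Matrix (↥(pbox (towerTorus Lc M' (n + 1))) × Fin (d + 1)) (↥(pbox (towerTorus Lc M' (n + 1))) × Fin (d + 1)) ℝ)
    (hH₂l : ∀ (r : ℝ) (x y z : V), H₂f (r • x + y) z = r • H₂f x z + H₂f y z) (hH₂r : ∀ (r : ℝ) (x y z : V), H₂f z (r • x + y) = r • H₂f z x + H₂f z y)
    (Q₁₂f : V → V → Matrix (↥(pbox M') × Fin (d + 1)) (↥(pbox (towerTorus Lc M' (n + 1))) × Fin (d + 1)) ℝ)
    (hQ₁₂l : ∀ (r : ℝ) (x y z : V), Q₁₂f (r • x + y) z = r • Q₁₂f x z + Q₁₂f y z) (hQ₁₂r : ∀ (r : ℝ) (x y z : V), Q₁₂f z (r • x + y) = r • Q₁₂f z x + Q₁₂f z y)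
    (Q₂₂f : V → V → Matrix κ (↥(pbox M') × Fin (d + 1)) ℝ)
    (hQ₂₂l : ∀ (r : ℝ) (x y z : V), Q₂₂f (r • x + y) z = r • Q₂₂f x z + Q₂₂f y z) (hQ₂₂r : ∀ (r : ℝ) (x y z : V), Q₂₂f z (r • x + y) = r • Q₂₂f z x + Q₂₂f z y)
    -- #21's composite and one-shot NAMINGS as functions (`h𝔔₁ h𝔔₂ k1 k2 q1 q2`; `X := −(c • diagonal (λ ∘ pr))` at `λ := lv v`; order 2 in two slots)
    (𝔔₁f : V → Matrix κ (↥(pbox (towerTorus Lc M' (n + 1))) × Fin (d + 1)) ℝ) (h𝔔₁ : ∀ v, Q₂₁f v * Q₁₀ + Q₂₀ * Q₁₁f v = 𝔔₁f v)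
    (𝔔₂f : V → V → Matrix κ (↥(pbox (towerTorus Lc M' (n + 1))) × Fin (d + 1)) ℝ)
    (h𝔔₂ : ∀ v v', Q₂₂f v v' * Q₁₀ + Q₂₁f v * Q₁₁f v' + (Q₂₁f v * Q₁₁f v' + Q₂₀ * Q₁₂f v v') = 𝔔₂f v v')
    (H'₁f : V → Matrix (↥(pbox (towerTorus Lc M' (n + 1))) × Fin (d + 1)) (↥(pbox (towerTorus Lc M' (n + 1))) × Fin (d + 1)) ℝ)
    (hH'₁f : ∀ v, H'₁f v = -((-(c • Matrix.diagonal (fun b : (↥(pbox (towerTorus Lc M' (n + 1))) × Fin (d + 1)) => lv v b.1)))ᵀ * H₀) + H₁f v + H₀ * (-(c • Matrix.diagonal (fun b : (↥(pbox (towerTorus Lc M' (n + 1))) × Fin (d + 1)) => lv v b.1))))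
    (H'₂f : V → V → Matrix (↥(pbox (towerTorus Lc M' (n + 1))) × Fin (d + 1)) (↥(pbox (towerTorus Lc M' (n + 1))) × Fin (d + 1)) ℝ)
    (hH'₂f : ∀ v v', H'₂f v v' = ((-(c • Matrix.diagonal (fun b : (↥(pbox (towerTorus Lc M' (n + 1))) × Fin (d + 1)) => lv v b.1))) * (-(c • Matrix.diagonal (fun b : (↥(pbox (towerTorus Lc M' (n + 1))) × Fin (d + 1)) => lv v' b.1))))ᵀ * H₀ + (-((-(c • Matrix.diagonal (fun b : (↥(pbox (towerTorus Lc M' (n + 1))) × Fin (d + 1)) => lv v b.1)))ᵀ * H₁f v') + -((-(c • Matrix.diagonal (fun b : (↥(pbox (towerTorus Lc M' (n + 1))) × Fin (d + 1)) => lv v b.1)))ᵀ * H₀ * (-(c • Matrix.diagonal (fun b : (↥(pbox (towerTorus Lc M' (n + 1))) × Fin (d + 1)) => lv v' b.1)))))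
      + ((-((-(c • Matrix.diagonal (fun b : (↥(pbox (towerTorus Lc M' (n + 1))) × Fin (d + 1)) => lv v b.1)))ᵀ * H₁f v') + -((-(c • Matrix.diagonal (fun b : (↥(pbox (towerTorus Lc M' (n + 1))) × Fin (d + 1)) => lv v b.1)))ᵀ * H₀ * (-(c • Matrix.diagonal (fun b : (↥(pbox (towerTorus Lc M' (n + 1))) × Fin (d + 1)) => lv v' b.1))))) + (H₂f v v' + H₁f v * (-(c • Matrix.diagonal (fun b : (↥(pbox (towerTorus Lc M' (n + 1))) × Fin (d + 1)) => lv v' b.1))) + (H₁f v * (-(c • Matrix.diagonal (fun b : (↥(pbox (towerTorus Lc M' (n + 1))) × Fin (d + 1)) => lv v' b.1))) + H₀ * ((-(c • Matrix.diagonal (fun b : (↥(pbox (towerTorus Lc M' (n + 1))) × Fin (d + 1)) => lv v b.1))) * (-(c • Matrix.diagonal (fun b : (↥(pbox (towerTorus Lc M' (n + 1))) × Fin (d + 1)) => lv v' b.1))))))))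
    (𝔔'₁f : V → Matrix κ (↥(pbox (towerTorus Lc M' (n + 1))) × Fin (d + 1)) ℝ) (h𝔔'₁f : ∀ v, 𝔔'₁f v = Xbf v * 𝔔₀ + 𝔔₁f v + 𝔔₀ * (-(c • Matrix.diagonal (fun b : (↥(pbox (towerTorus Lc M' (n + 1))) × Fin (d + 1)) => lv v b.1))))
    (𝔔'₂f : V → V → Matrix κ (↥(pbox (towerTorus Lc M' (n + 1))) × Fin (d + 1)) ℝ)
    (h𝔔'₂f : ∀ v v', 𝔔'₂f v v' = Xbf v * Xbf v' * 𝔔₀ + (Xbf v * 𝔔₁f v' + Xbf v * 𝔔₀ * (-(c • Matrix.diagonal (fun b : (↥(pbox (towerTorus Lc M' (n + 1))) × Fin (d + 1)) => lv v' b.1))))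
      + ((Xbf v * 𝔔₁f v' + Xbf v * 𝔔₀ * (-(c • Matrix.diagonal (fun b : (↥(pbox (towerTorus Lc M' (n + 1))) × Fin (d + 1)) => lv v' b.1)))) + (𝔔₂f v v' + 𝔔₁f v * (-(c • Matrix.diagonal (fun b : (↥(pbox (towerTorus Lc M' (n + 1))) × Fin (d + 1)) => lv v' b.1))) + (𝔔₁f v * (-(c • Matrix.diagonal (fun b : (↥(pbox (towerTorus Lc M' (n + 1))) × Fin (d + 1)) => lv v' b.1))) + 𝔔₀ * ((-(c • Matrix.diagonal (fun b : (↥(pbox (towerTorus Lc M' (n + 1))) × Fin (d + 1)) => lv v b.1))) * (-(c • Matrix.diagonal (fun b : (↥(pbox (towerTorus Lc M' (n + 1))) × Fin (d + 1)) => lv v' b.1))))))))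
    -- #21's generator jets by their closed forms at `h := hv v` (weight `h`), per direction
    (W₁f W₂f : V → Matrix (↥(pbox (towerTorus Lc M' (n + 1))) × Fin (d + 1)) (NParam Lc M' rs (n + 1)) ℝ)
    (hW₁f : ∀ v, W₁f v = Matrix.of fun (b : (↥(pbox (towerTorus Lc M' (n + 1))) × Fin (d + 1))) (e : (NParam Lc M' rs (n + 1))) => -(c * hv v b * evalN Lc M' rs (n + 1) (fun b' : (↥(pbox (towerTorus Lc M' (n + 1))) × Fin (d + 1)) => (b'.1 : Site (d + 1)) + unitVec b'.2) b e))
    (hW₂f : ∀ v, W₂f v = Matrix.of fun (b : (↥(pbox (towerTorus Lc M' (n + 1))) × Fin (d + 1))) (e : (NParam Lc M' rs (n + 1))) => (c * hv v b) ^ 2 * evalN Lc M' rs (n + 1) (fun b' : (↥(pbox (towerTorus Lc M' (n + 1))) × Fin (d + 1)) => (b'.1 : Site (d + 1)) + unitVec b'.2) b e)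
    -- the (COV-m) order-1∕2 images and the (WARD-m) sources, per direction (free)
    (Db₁f Db₂f : V → Matrix (↥(pbox M') × Fin (d + 1)) (Res (toSite (rs 0)) Lc M') ℝ) (Y₁f Y₂f : V → Matrix κ (NParam Lc M' rs (n + 1)) ℝ)
    -- the `G`-side DRESSED WORDS, NAMED (#36b's shapes at `B := [Q₁₁f v; 0]`)
    (Gw₁f : V → Matrix (↥(pbox M') × Fin (d + 1)) (↥(pbox M') × Fin (d + 1)) ℝ)
    (hGw₁f : ∀ v, Gw₁f v = ((L * (H₁f v) - S * (fromRows (Q₁₁f v) (0 : Matrix (NParam Lc (fine Lc M') (fun k => rs (k + 1)) n) (↥(pbox (towerTorus Lc M' (n + 1))) × Fin (d + 1)) ℝ))) * I + L * (fromRows (Q₁₁f v) (0 : Matrix (NParam Lc (fine Lc M') (fun k => rs (k + 1)) n) (↥(pbox (towerTorus Lc M' (n + 1))) × Fin (d + 1)) ℝ))ᵀ * S).toBlocks₁₁)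
    (Gw₂f : V → V → Matrix (↥(pbox M') × Fin (d + 1)) (↥(pbox M') × Fin (d + 1)) ℝ)
    (hGw₂f : ∀ v v', Gw₂f v v' =
      ((((-((L * (H₁f v) - S * (fromRows (Q₁₁f v) (0 : Matrix (NParam Lc (fine Lc M') (fun k => rs (k + 1)) n) (↥(pbox (towerTorus Lc M' (n + 1))) × Fin (d + 1)) ℝ))) * Γ - L * (fromRows (Q₁₁f v) (0 : Matrix (NParam Lc (fine Lc M') (fun k => rs (k + 1)) n) (↥(pbox (towerTorus Lc M' (n + 1))) × Fin (d + 1)) ℝ))ᵀ * L) * (H₁f v') + L * (H₂f v v')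
          - (((L * (H₁f v) - S * (fromRows (Q₁₁f v) (0 : Matrix (NParam Lc (fine Lc M') (fun k => rs (k + 1)) n) (↥(pbox (towerTorus Lc M' (n + 1))) × Fin (d + 1)) ℝ))) * I + L * (fromRows (Q₁₁f v) (0 : Matrix (NParam Lc (fine Lc M') (fun k => rs (k + 1)) n) (↥(pbox (towerTorus Lc M' (n + 1))) × Fin (d + 1)) ℝ))ᵀ * S) * (fromRows (Q₁₁f v') (0 : Matrix (NParam Lc (fine Lc M') (fun k => rs (k + 1)) n) (↥(pbox (towerTorus Lc M' (n + 1))) × Fin (d + 1)) ℝ)) + S * (fromRows (Q₁₂f v v') (0 : Matrix (NParam Lc (fine Lc M') (fun k => rs (k + 1)) n) (↥(pbox (towerTorus Lc M' (n + 1))) × Fin (d + 1)) ℝ)))) * I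
        + (L * (H₁f v) - S * (fromRows (Q₁₁f v) (0 : Matrix (NParam Lc (fine Lc M') (fun k => rs (k + 1)) n) (↥(pbox (towerTorus Lc M' (n + 1))) × Fin (d + 1)) ℝ))) * (-((Γ * (H₁f v') + I * (fromRows (Q₁₁f v') (0 : Matrix (NParam Lc (fine Lc M') (fun k => rs (k + 1)) n) (↥(pbox (towerTorus Lc M' (n + 1))) × Fin (d + 1)) ℝ))) * I + Γ * (fromRows (Q₁₁f v') (0 : Matrix (NParam Lc (fine Lc M') (fun k => rs (k + 1)) n) (↥(pbox (towerTorus Lc M' (n + 1))) × Fin (d + 1)) ℝ))ᵀ * S)))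
      - ((-((L * (H₁f v) - S * (fromRows (Q₁₁f v) (0 : Matrix (NParam Lc (fine Lc M') (fun k => rs (k + 1)) n) (↥(pbox (towerTorus Lc M' (n + 1))) × Fin (d + 1)) ℝ))) * Γ - L * (fromRows (Q₁₁f v) (0 : Matrix (NParam Lc (fine Lc M') (fun k => rs (k + 1)) n) (↥(pbox (towerTorus Lc M' (n + 1))) × Fin (d + 1)) ℝ))ᵀ * L) * (-(fromRows (Q₁₁f v') (0 : Matrix (NParam Lc (fine Lc M') (fun k => rs (k + 1)) n) (↥(pbox (towerTorus Lc M' (n + 1))) × Fin (d + 1)) ℝ))ᵀ) + L * (fromRows (Q₁₂f v v') (0 : Matrix (NParam Lc (fine Lc M') (fun k => rs (k + 1)) n) (↥(pbox (towerTorus Lc M' (n + 1))) × Fin (d + 1)) ℝ))ᵀ) * S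
          + L * (-(fromRows (Q₁₁f v) (0 : Matrix (NParam Lc (fine Lc M') (fun k => rs (k + 1)) n) (↥(pbox (towerTorus Lc M' (n + 1))) × Fin (d + 1)) ℝ))ᵀ) * ((L * (H₁f v') - S * (fromRows (Q₁₁f v') (0 : Matrix (NParam Lc (fine Lc M') (fun k => rs (k + 1)) n) (↥(pbox (towerTorus Lc M' (n + 1))) × Fin (d + 1)) ℝ))) * I + L * (fromRows (Q₁₁f v') (0 : Matrix (NParam Lc (fine Lc M') (fun k => rs (k + 1)) n) (↥(pbox (towerTorus Lc M' (n + 1))) × Fin (d + 1)) ℝ))ᵀ * S)))).toBlocks₁₁)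
    -- #21's ROWS, FOR EVERY DIRECTION: the coarse chart's Faddeev–Popov 2-jet, the form parities, the graded Ward rows, (COV-m) orders 1, 2 on both levels
    (uTop : ∀ v, secondVar (τ₂ * Dbar) (τ₂ * Db₁f v) (τ₂ * Db₂f v) = 0)
    (hH₁t : ∀ v, (H₁f v)ᵀ = -H₁f v) (hH₂t : ∀ v, (H₂f v v)ᵀ = H₂f v v)
    -- (WARD-m) ORDER 0 and the top step's (COV-m) ORDER 0 — direction-free, DISPLAYED for the abstract families (rooted: `torus_a0_tower` ∕ `Qtop_mul_smul_tgrad_res`)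
    (a0 : H₀ * W₀ = 0) (d0 : Q₂₀ * Dbar = 0)
    (a1 : ∀ v, H₁f v * W₀ + H₀ * W₁f v = 𝔔₀ᵀ * Y₁f v)
    (a2 : ∀ v, H₂f v v * W₀ + (2 : ℝ) • (H₁f v * W₁f v) + H₀ * W₂f v = -((2 : ℝ) • ((𝔔₁f v)ᵀ * Y₁f v)) + 𝔔₀ᵀ * Y₂f v)
    (c1 : ∀ v, Q₁₁f v * W₀ + Q₁₀ * W₁f v = fromCols (Db₁f v) (0 : Matrix (↥(pbox M') × Fin (d + 1)) (NParam Lc (fine Lc M') (fun k => rs (k + 1)) n) ℝ))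
    (c2 : ∀ v, Q₁₂f v v * W₀ + (2 : ℝ) • (Q₁₁f v * W₁f v) + Q₁₀ * W₂f v = fromCols (Db₂f v) (0 : Matrix (↥(pbox M') × Fin (d + 1)) (NParam Lc (fine Lc M') (fun k => rs (k + 1)) n) ℝ))
    (d1 : ∀ v, Q₂₁f v * Dbar + Q₂₀ * Db₁f v = 0) (d2 : ∀ v, Q₂₂f v v * Dbar + (2 : ℝ) • (Q₂₁f v * Db₁f v) + Q₂₀ * Db₂f v = 0)
    -- a finite family of directions, a pair
    {σ : Type*} [Fintype σ] [DecidableEq σ] (dv : σ → V) (k l : σ)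
    -- (S3-1) N — the ONE-SHOT system of depth `n+2`: right inverse and its LEG PRESENTED over a chart kernel `A_N` under the torus rules: DISPLAYED (#41d VERBATIM)
    {XN : Matrix ((↥(pbox (towerTorus Lc M' (n + 1))) × Fin (d + 1)) ⊕ (κ ⊕ (NParam Lc M' rs (n + 1)))) ((↥(pbox (towerTorus Lc M' (n + 1))) × Fin (d + 1)) ⊕ (κ ⊕ (NParam Lc M' rs (n + 1)))) ℝ} (hXN : kkt H₀ (fromRows 𝔔₀ P) * XN = 1)
    (ρN : Fin (d + 1) → ℤ) (LNc : ℕ) (fN : κ → Idx (towerTorus Lc M' (n + 1)) (Fib d)) (hfN : Function.Injective fN)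
    (hmN : ∀ a : κ, ∃ m : Fin (d + 1), (fN a).2 = Sum.inr m)
    (hcN : ∀ (s : ↥(pbox (towerTorus Lc M' (n + 1)))) (m : Fin (d + 1)), ((s, Sum.inr m) : Idx (towerTorus Lc M' (n + 1)) (Fib d)) ∈ Set.range fN ↔ Torus.proj LNc (s : Site (d + 1)) = 0)
    {AN : MKer (d + 1) (Fib d)} (hEAN : perF (towerTorus Lc M' (n + 1)) (axEc ρN LNc) * perF (towerTorus Lc M' (n + 1)) AN = perF (towerTorus Lc M' (n + 1)) AN)
    (hAEN : perF (towerTorus Lc M' (n + 1)) AN * perF (towerTorus Lc M' (n + 1)) (axEc ρN LNc) = perF (towerTorus Lc M' (n + 1)) AN)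
    (hLN : XN.submatrix (Sum.map id Sum.inl) (Sum.map id Sum.inl) = fromBlocks
      (Matrix.of fun (b b' : (↥(pbox (towerTorus Lc M' (n + 1))) × Fin (d + 1))) =>
        axEc ρN LNc (b.1 : Site (d + 1)) (b.1 : Site (d + 1)) (Sum.inl b.2) (Sum.inl b.2)
          * (axEc ρN LNc (b'.1 : Site (d + 1)) (b'.1 : Site (d + 1)) (Sum.inl b'.2) (Sum.inl b'.2) * perF (towerTorus Lc M' (n + 1)) AN (b.1, Sum.inl b.2) (b'.1, Sum.inl b'.2)))
      (Matrix.of fun (b : (↥(pbox (towerTorus Lc M' (n + 1))) × Fin (d + 1))) (a : κ) =>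
        axEc ρN LNc (b.1 : Site (d + 1)) (b.1 : Site (d + 1)) (Sum.inl b.2) (Sum.inl b.2) * perF (towerTorus Lc M' (n + 1)) AN (b.1, Sum.inl b.2) (fN a))
      (-Matrix.of fun (a : κ) (b : (↥(pbox (towerTorus Lc M' (n + 1))) × Fin (d + 1))) =>
        axEc ρN LNc (b.1 : Site (d + 1)) (b.1 : Site (d + 1)) (Sum.inl b.2) (Sum.inl b.2) * perF (towerTorus Lc M' (n + 1)) AN (fN a) (b.1, Sum.inl b.2))
      (-((perF (towerTorus Lc M' (n + 1)) AN).submatrix fN fN)))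
    -- (S3-2) N — the one-shot jets NAMED as full-index torus matrices: parities + block bindings DISPLAYED (#41d VERBATIM)
    (VN VN' WN : Matrix (Idx (towerTorus Lc M' (n + 1)) (Fib d)) (Idx (towerTorus Lc M' (n + 1)) (Fib d)) ℝ)
    (hVNm : ∀ a a' : κ, VN (fN a) (fN a') = 0)
    (hVNt : ∀ (b : (↥(pbox (towerTorus Lc M' (n + 1))) × Fin (d + 1))) (a : κ), VN (b.1, Sum.inl b.2) (fN a) = VN (fN a) (b.1, Sum.inl b.2))
    (hVN'm : ∀ a a' : κ, VN' (fN a) (fN a') = 0)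
    (hVN't : ∀ (b : (↥(pbox (towerTorus Lc M' (n + 1))) × Fin (d + 1))) (a : κ), VN' (b.1, Sum.inl b.2) (fN a) = VN' (fN a) (b.1, Sum.inl b.2))
    (hWNm : ∀ a a' : κ, WN (fN a) (fN a') = 0)
    (hWNt : ∀ (b : (↥(pbox (towerTorus Lc M' (n + 1))) × Fin (d + 1))) (a : κ), WN (b.1, Sum.inl b.2) (fN a) = -WN (fN a) (b.1, Sum.inl b.2))
    (hHN₁ : H'₁f (dv k) = VN.submatrix (fun b : (↥(pbox (towerTorus Lc M' (n + 1))) × Fin (d + 1)) => ((b.1, Sum.inl b.2) : Idx (towerTorus Lc M' (n + 1)) (Fib d))) (fun b : (↥(pbox (towerTorus Lc M' (n + 1))) × Fin (d + 1)) => ((b.1, Sum.inl b.2) : Idx (towerTorus Lc M' (n + 1)) (Fib d))))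
    (hQN₁ : 𝔔'₁f (dv k) = VN.submatrix fN (fun b : (↥(pbox (towerTorus Lc M' (n + 1))) × Fin (d + 1)) => ((b.1, Sum.inl b.2) : Idx (towerTorus Lc M' (n + 1)) (Fib d))))
    (hHN₁' : H'₁f (dv l) = VN'.submatrix (fun b : (↥(pbox (towerTorus Lc M' (n + 1))) × Fin (d + 1)) => ((b.1, Sum.inl b.2) : Idx (towerTorus Lc M' (n + 1)) (Fib d))) (fun b : (↥(pbox (towerTorus Lc M' (n + 1))) × Fin (d + 1)) => ((b.1, Sum.inl b.2) : Idx (towerTorus Lc M' (n + 1)) (Fib d))))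
    (hQN₁' : 𝔔'₁f (dv l) = VN'.submatrix fN (fun b : (↥(pbox (towerTorus Lc M' (n + 1))) × Fin (d + 1)) => ((b.1, Sum.inl b.2) : Idx (towerTorus Lc M' (n + 1)) (Fib d))))
    (hHN₂ : (1 / 2 : ℝ) • (H'₂f (dv k) (dv l) + H'₂f (dv l) (dv k)) = WN.submatrix (fun b : (↥(pbox (towerTorus Lc M' (n + 1))) × Fin (d + 1)) => ((b.1, Sum.inl b.2) : Idx (towerTorus Lc M' (n + 1)) (Fib d))) (fun b : (↥(pbox (towerTorus Lc M' (n + 1))) × Fin (d + 1)) => ((b.1, Sum.inl b.2) : Idx (towerTorus Lc M' (n + 1)) (Fib d))))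
    (hQN₂ : (1 / 2 : ℝ) • (𝔔'₂f (dv k) (dv l) + 𝔔'₂f (dv l) (dv k)) = WN.submatrix fN (fun b : (↥(pbox (towerTorus Lc M' (n + 1))) × Fin (d + 1)) => ((b.1, Sum.inl b.2) : Idx (towerTorus Lc M' (n + 1)) (Fib d))))
    -- (S3-1) F — the ONE-SHOT system of the tower below (depth `n+1`, same finest torus): right inverse and LEG PRESENTED: DISPLAYED (#41d VERBATIM)
    {XF : Matrix ((↥(pbox (towerTorus Lc M' (n + 1))) × Fin (d + 1)) ⊕ ((↥(pbox M') × Fin (d + 1)) ⊕ (NParam Lc (fine Lc M') (fun k => rs (k + 1)) n))) ((↥(pbox (towerTorus Lc M' (n + 1))) × Fin (d + 1)) ⊕ ((↥(pbox M') × Fin (d + 1)) ⊕ (NParam Lc (fine Lc M') (fun k => rs (k + 1)) n))) ℝ} (hXF : kkt H₀ (fromRows Q₁₀ τ₁) * XF = 1)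
    (ρF : Fin (d + 1) → ℤ) (LFc : ℕ) (fF : (↥(pbox M') × Fin (d + 1)) → Idx (towerTorus Lc M' (n + 1)) (Fib d)) (hfF : Function.Injective fF)
    (hmF : ∀ a : (↥(pbox M') × Fin (d + 1)), ∃ m : Fin (d + 1), (fF a).2 = Sum.inr m)
    (hcF : ∀ (s : ↥(pbox (towerTorus Lc M' (n + 1)))) (m : Fin (d + 1)), ((s, Sum.inr m) : Idx (towerTorus Lc M' (n + 1)) (Fib d)) ∈ Set.range fF ↔ Torus.proj LFc (s : Site (d + 1)) = 0)
    {AF : MKer (d + 1) (Fib d)} (hEAF : perF (towerTorus Lc M' (n + 1)) (axEc ρF LFc) * perF (towerTorus Lc M' (n + 1)) AF = perF (towerTorus Lc M' (n + 1)) AF)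
    (hAEF : perF (towerTorus Lc M' (n + 1)) AF * perF (towerTorus Lc M' (n + 1)) (axEc ρF LFc) = perF (towerTorus Lc M' (n + 1)) AF)
    (hLF : XF.submatrix (Sum.map id Sum.inl) (Sum.map id Sum.inl) = fromBlocks
      (Matrix.of fun (b b' : (↥(pbox (towerTorus Lc M' (n + 1))) × Fin (d + 1))) =>
        axEc ρF LFc (b.1 : Site (d + 1)) (b.1 : Site (d + 1)) (Sum.inl b.2) (Sum.inl b.2)
          * (axEc ρF LFc (b'.1 : Site (d + 1)) (b'.1 : Site (d + 1)) (Sum.inl b'.2) (Sum.inl b'.2) * perF (towerTorus Lc M' (n + 1)) AF (b.1, Sum.inl b.2) (b'.1, Sum.inl b'.2)))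
      (Matrix.of fun (b : (↥(pbox (towerTorus Lc M' (n + 1))) × Fin (d + 1))) (a : (↥(pbox M') × Fin (d + 1))) =>
        axEc ρF LFc (b.1 : Site (d + 1)) (b.1 : Site (d + 1)) (Sum.inl b.2) (Sum.inl b.2) * perF (towerTorus Lc M' (n + 1)) AF (b.1, Sum.inl b.2) (fF a))
      (-Matrix.of fun (a : (↥(pbox M') × Fin (d + 1))) (b : (↥(pbox (towerTorus Lc M' (n + 1))) × Fin (d + 1))) =>
        axEc ρF LFc (b.1 : Site (d + 1)) (b.1 : Site (d + 1)) (Sum.inl b.2) (Sum.inl b.2) * perF (towerTorus Lc M' (n + 1)) AF (fF a) (b.1, Sum.inl b.2))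
      (-((perF (towerTorus Lc M' (n + 1)) AF).submatrix fF fF)))
    -- (S3-2) F — the fine one-shot jets NAMED: parities + block bindings DISPLAYED (#41d VERBATIM)
    (VF VF' WF : Matrix (Idx (towerTorus Lc M' (n + 1)) (Fib d)) (Idx (towerTorus Lc M' (n + 1)) (Fib d)) ℝ)
    (hVFm : ∀ a a' : (↥(pbox M') × Fin (d + 1)), VF (fF a) (fF a') = 0)
    (hVFt : ∀ (b : (↥(pbox (towerTorus Lc M' (n + 1))) × Fin (d + 1))) (a : (↥(pbox M') × Fin (d + 1))), VF (b.1, Sum.inl b.2) (fF a) = VF (fF a) (b.1, Sum.inl b.2))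
    (hVF'm : ∀ a a' : (↥(pbox M') × Fin (d + 1)), VF' (fF a) (fF a') = 0)
    (hVF't : ∀ (b : (↥(pbox (towerTorus Lc M' (n + 1))) × Fin (d + 1))) (a : (↥(pbox M') × Fin (d + 1))), VF' (b.1, Sum.inl b.2) (fF a) = VF' (fF a) (b.1, Sum.inl b.2))
    (hWFm : ∀ a a' : (↥(pbox M') × Fin (d + 1)), WF (fF a) (fF a') = 0)
    (hWFt : ∀ (b : (↥(pbox (towerTorus Lc M' (n + 1))) × Fin (d + 1))) (a : (↥(pbox M') × Fin (d + 1))), WF (b.1, Sum.inl b.2) (fF a) = -WF (fF a) (b.1, Sum.inl b.2))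
    (hHF₁ : H₁f (dv k) = VF.submatrix (fun b : (↥(pbox (towerTorus Lc M' (n + 1))) × Fin (d + 1)) => ((b.1, Sum.inl b.2) : Idx (towerTorus Lc M' (n + 1)) (Fib d))) (fun b : (↥(pbox (towerTorus Lc M' (n + 1))) × Fin (d + 1)) => ((b.1, Sum.inl b.2) : Idx (towerTorus Lc M' (n + 1)) (Fib d))))
    (hQF₁ : Q₁₁f (dv k) = VF.submatrix fF (fun b : (↥(pbox (towerTorus Lc M' (n + 1))) × Fin (d + 1)) => ((b.1, Sum.inl b.2) : Idx (towerTorus Lc M' (n + 1)) (Fib d))))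
    (hHF₁' : H₁f (dv l) = VF'.submatrix (fun b : (↥(pbox (towerTorus Lc M' (n + 1))) × Fin (d + 1)) => ((b.1, Sum.inl b.2) : Idx (towerTorus Lc M' (n + 1)) (Fib d))) (fun b : (↥(pbox (towerTorus Lc M' (n + 1))) × Fin (d + 1)) => ((b.1, Sum.inl b.2) : Idx (towerTorus Lc M' (n + 1)) (Fib d))))
    (hQF₁' : Q₁₁f (dv l) = VF'.submatrix fF (fun b : (↥(pbox (towerTorus Lc M' (n + 1))) × Fin (d + 1)) => ((b.1, Sum.inl b.2) : Idx (towerTorus Lc M' (n + 1)) (Fib d))))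
    (hHF₂ : (1 / 2 : ℝ) • (H₂f (dv k) (dv l) + H₂f (dv l) (dv k)) = WF.submatrix (fun b : (↥(pbox (towerTorus Lc M' (n + 1))) × Fin (d + 1)) => ((b.1, Sum.inl b.2) : Idx (towerTorus Lc M' (n + 1)) (Fib d))) (fun b : (↥(pbox (towerTorus Lc M' (n + 1))) × Fin (d + 1)) => ((b.1, Sum.inl b.2) : Idx (towerTorus Lc M' (n + 1)) (Fib d))))
    (hQF₂ : (1 / 2 : ℝ) • (Q₁₂f (dv k) (dv l) + Q₁₂f (dv l) (dv k)) = WF.submatrix fF (fun b : (↥(pbox (towerTorus Lc M' (n + 1))) × Fin (d + 1)) => ((b.1, Sum.inl b.2) : Idx (towerTorus Lc M' (n + 1)) (Fib d))))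
    -- (S3-1) G — NEW IN THE `-G` EDITION: the TOP COMB system over the ABSTRACT form `K (lev 0) (rs 0)` — a right inverse `X_G` of the UNSCALED comb-KKT and
    -- its LEG PRESENTED over an abstract chart kernel `A_G` under the torus rules on `M′`, the top multipliers' packing injection `f_G`: DISPLAYED
    -- (rooted instance = #41d: #41b `kkt_mul_inv_combAt ∕ packedLeg_combAt_eq ∕ perF_rules_combAt` at `A_G := Π̂ᵀ(KInvStep Lc (lev 0))Π̂ @ rs 0`, `f_G` = #21's
    -- slot presentation, `(ρ_G, L_G) = (toSite (rs 0), Lc)`; sym instance: leaf-05's sym comb leg at the (0.4)-symmetrised top step)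
    {XG : Matrix ((↥(pbox M') × Fin (d + 1)) ⊕ (κ ⊕ (Res (toSite (rs 0)) Lc M'))) ((↥(pbox M') × Fin (d + 1)) ⊕ (κ ⊕ (Res (toSite (rs 0)) Lc M'))) ℝ}
    (hXG : kkt ((perF M' (K (lev 0) (rs 0))).submatrix (fun b : (↥(pbox M') × Fin (d + 1)) => ((b.1, Sum.inl b.2) : Idx M' (Fib d))) (fun b : (↥(pbox M') × Fin (d + 1)) => ((b.1, Sum.inl b.2) : Idx M' (Fib d)))) (fromRows Q₂₀ τ₂) * XG = 1)
    (ρG : Fin (d + 1) → ℤ) (LGc : ℕ) (fG : κ → Idx M' (Fib d)) (hfG : Function.Injective fG)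
    (hmG : ∀ a : κ, ∃ m : Fin (d + 1), (fG a).2 = Sum.inr m)
    (hcG : ∀ (s : ↥(pbox M')) (m : Fin (d + 1)), ((s, Sum.inr m) : Idx M' (Fib d)) ∈ Set.range fG ↔ Torus.proj LGc (s : Site (d + 1)) = 0)
    {AG : MKer (d + 1) (Fib d)} (hEAG : perF M' (axEc ρG LGc) * perF M' AG = perF M' AG)
    (hAEG : perF M' AG * perF M' (axEc ρG LGc) = perF M' AG)
    (hLG : XG.submatrix (Sum.map id Sum.inl) (Sum.map id Sum.inl) = fromBlocks
      (Matrix.of fun (b b' : (↥(pbox M') × Fin (d + 1))) =>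
        axEc ρG LGc (b.1 : Site (d + 1)) (b.1 : Site (d + 1)) (Sum.inl b.2) (Sum.inl b.2)
          * (axEc ρG LGc (b'.1 : Site (d + 1)) (b'.1 : Site (d + 1)) (Sum.inl b'.2) (Sum.inl b'.2) * perF (M') AG (b.1, Sum.inl b.2) (b'.1, Sum.inl b'.2)))
      (Matrix.of fun (b : (↥(pbox M') × Fin (d + 1))) (a : κ) =>
        axEc ρG LGc (b.1 : Site (d + 1)) (b.1 : Site (d + 1)) (Sum.inl b.2) (Sum.inl b.2) * perF (M') AG (b.1, Sum.inl b.2) (fG a))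
      (-Matrix.of fun (a : κ) (b : (↥(pbox M') × Fin (d + 1))) =>
        axEc ρG LGc (b.1 : Site (d + 1)) (b.1 : Site (d + 1)) (Sum.inl b.2) (Sum.inl b.2) * perF (M') AG (fG a) (b.1, Sum.inl b.2))
      (-((perF (M') AG).submatrix fG fG)))
    -- (S3-2) G — the top comb's jets NAMED, the H-blocks CARRYING THE UNIT `∏_{i<n+1} wVH d Lc (lev i)` of the composite's effective form (leaf-06 G-5
    -- `torus_kkt_nondeg_towerG` .2.2 fed by leaf-05's composite (INV)(EFF) letters; #40a moves it from the leg onto the blocks): parities + block bindings DISPLAYED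
    (VG VG' WG : Matrix (Idx (M') (Fib d)) (Idx (M') (Fib d)) ℝ)
    (hVGm : ∀ a a' : κ, VG (fG a) (fG a') = 0)
    (hVGt : ∀ (b : (↥(pbox M') × Fin (d + 1))) (a : κ), VG (b.1, Sum.inl b.2) (fG a) = VG (fG a) (b.1, Sum.inl b.2))
    (hVG'm : ∀ a a' : κ, VG' (fG a) (fG a') = 0)
    (hVG't : ∀ (b : (↥(pbox M') × Fin (d + 1))) (a : κ), VG' (b.1, Sum.inl b.2) (fG a) = VG' (fG a) (b.1, Sum.inl b.2))
    (hWGm : ∀ a a' : κ, WG (fG a) (fG a') = 0)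
    (hWGt : ∀ (b : (↥(pbox M') × Fin (d + 1))) (a : κ), WG (b.1, Sum.inl b.2) (fG a) = -WG (fG a) (b.1, Sum.inl b.2))
    (hHG₁ : (∏ i ∈ range (n + 1), wVH d Lc (lev i)) • Gw₁f (dv k) = VG.submatrix (fun b : (↥(pbox M') × Fin (d + 1)) => ((b.1, Sum.inl b.2) : Idx M' (Fib d))) (fun b : (↥(pbox M') × Fin (d + 1)) => ((b.1, Sum.inl b.2) : Idx M' (Fib d))))
    (hQG₁ : Q₂₁f (dv k) = VG.submatrix fG (fun b : (↥(pbox M') × Fin (d + 1)) => ((b.1, Sum.inl b.2) : Idx M' (Fib d))))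
    (hHG₁' : (∏ i ∈ range (n + 1), wVH d Lc (lev i)) • Gw₁f (dv l) = VG'.submatrix (fun b : (↥(pbox M') × Fin (d + 1)) => ((b.1, Sum.inl b.2) : Idx M' (Fib d))) (fun b : (↥(pbox M') × Fin (d + 1)) => ((b.1, Sum.inl b.2) : Idx M' (Fib d))))
    (hQG₁' : Q₂₁f (dv l) = VG'.submatrix fG (fun b : (↥(pbox M') × Fin (d + 1)) => ((b.1, Sum.inl b.2) : Idx M' (Fib d))))
    (hHG₂ : (∏ i ∈ range (n + 1), wVH d Lc (lev i)) • ((1 / 2 : ℝ) • (Gw₂f (dv k) (dv l) + Gw₂f (dv l) (dv k))) = WG.submatrix (fun b : (↥(pbox M') × Fin (d + 1)) => ((b.1, Sum.inl b.2) : Idx M' (Fib d))) (fun b : (↥(pbox M') × Fin (d + 1)) => ((b.1, Sum.inl b.2) : Idx M' (Fib d))))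
    (hQG₂ : (1 / 2 : ℝ) • (Q₂₂f (dv k) (dv l) + Q₂₂f (dv l) (dv k)) = WG.submatrix fG (fun b : (↥(pbox M') × Fin (d + 1)) => ((b.1, Sum.inl b.2) : Idx M' (Fib d))))
    : hessT (perF (towerTorus Lc M' (n + 1)) AN) VN VN' WN
      = hessT (perF (towerTorus Lc M' (n + 1)) AF) VF VF' WF + hessT (perF M' AG) VG VG' WG := by
  have hL0 : 0 < Lc := Nat.pos_of_ne_zero (NeZero.ne Lc)
  have hw : (∏ i ∈ range (n + 1), wVH d Lc (lev i)) ≠ 0 := Finset.prod_ne_zero_iff.mpr fun i _ => (wVH_pos (d := d) hL0 (lev i)).ne'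
  have hwi : (∏ i ∈ range (n + 1), (wVH d Lc (lev i))⁻¹) ≠ 0 := Finset.prod_ne_zero_iff.mpr fun i _ => inv_ne_zero (wVH_pos (d := d) hL0 (lev i)).ne'
  -- leaf-05's composite (INV-m)(EFF-m) on the NESTED slice for `(Q, K)`, at the pinned `H₀ Q₁₀`
  have hIE := torus_composite_inv_and_eff_G Lc Q K n M' lev rs hlev hone hId
  have hInv : (kkt H₀ (fromRows Q₁₀ (nestedSliceG Lc Q (fine Lc M') (fun k => lev (k + 1)) (fun k => rs (k + 1)) n))).det ≠ 0 := by
    rw [hH₀, hQ₁₀]; exact hIE.1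
  have hEff : (effForm H₀ (fromRows Q₁₀ (nestedSliceG Lc Q (fine Lc M') (fun k => lev (k + 1)) (fun k => rs (k + 1)) n))).toBlocks₁₁
      = (∏ i ∈ range (n + 1), (wVH d Lc (lev i))⁻¹) • ((perF M' (K (lev 0) (rs 0))).submatrix (fun b : (↥(pbox M') × Fin (d + 1)) => ((b.1, Sum.inl b.2) : Idx M' (Fib d))) (fun b : (↥(pbox M') × Fin (d + 1)) => ((b.1, Sum.inl b.2) : Idx M' (Fib d)))) := by
    rw [hH₀, hQ₁₀]; exact hIE.2 (rs 0)
  have a0' : H₀ * towerGen Lc M' rs (n + 1) = 0 := by rw [← hW₀]; exact a0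
  have c0' : Q₁₀ * towerGen Lc M' rs (n + 1) = fromCols Dbar (0 : Matrix (↥(pbox M') × Fin (d + 1)) (NParam Lc (fine Lc M') (fun k => rs (k + 1)) n) ℝ) := by rw [← hW₀]; exact c0
  -- the coarse form of #21-G's G system IS the unit-scaled top step form (leaf-06 G-5 `torus_kkt_nondeg_towerG` .2.2 across the one-shot slice change)
  have hS₁₁ : S.toBlocks₁₁ = (∏ i ∈ range (n + 1), wVH d Lc (lev i))⁻¹ • ((perF M' (K (lev 0) (rs 0))).submatrix (fun b : (↥(pbox M') × Fin (d + 1)) => ((b.1, Sum.inl b.2) : Idx M' (Fib d))) (fun b : (↥(pbox M') × Fin (d + 1)) => ((b.1, Sum.inl b.2) : Idx M' (Fib d)))) := by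
    rw [← Finset.prod_inv_distrib, ← hS]
    exact (torus_kkt_nondeg_towerG M' Lc lev rs n Q hrs H₀ hτ₁ τ₂ Q₂₀ Dbar c0' hSL a0' hH₀t hInv hwi hEff (isUnit_iff_ne_zero.mpr htop)).2.2
  -- the displayed right inverse of the UNSCALED top comb system and its unit conjugate (#40a (U2))
  have hXG' : kkt S.toBlocks₁₁ (fromRows Q₂₀ τ₂) * (fromBlocks (1 : Matrix (↥(pbox M') × Fin (d + 1)) (↥(pbox M') × Fin (d + 1)) ℝ) 0 0 ((∏ i ∈ range (n + 1), wVH d Lc (lev i))⁻¹ • (1 : Matrix (κ ⊕ (Res (toSite (rs 0)) Lc M')) (κ ⊕ (Res (toSite (rs 0)) Lc M')) ℝ))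
          * XG * fromBlocks ((∏ i ∈ range (n + 1), wVH d Lc (lev i)) • (1 : Matrix (↥(pbox M') × Fin (d + 1)) (↥(pbox M') × Fin (d + 1)) ℝ)) 0 0 (1 : Matrix (κ ⊕ (Res (toSite (rs 0)) Lc M')) (κ ⊕ (Res (toSite (rs 0)) Lc M')) ℝ)) = 1 := by
    rw [hS₁₁]; exact kkt_inv_smul_mul_rightInverse (∏ i ∈ range (n + 1), wVH d Lc (lev i)) hw _ _ _ hXG
  -- #41c-G at the constructed inverse of #21-G's coarse system
  have h41 := hessT_kernel_law_tower_G M' Lc lev rs n Q K hrs hlev hM' (hH₀ := hH₀) (hQ₁₀ := hQ₁₀) (hτ₁ := hτ₁) (hH₀t := hH₀t) (hone := hone) (hId := hId) (hSL := hSL) (hτ₂ := hτ₂) (Q₂₀ := Q₂₀) (htop := htop) (hW₀ := hW₀) (hP := hP) (c := c) (hDbar := hDbar) (c0 := c0) (hTW := hTW) (hΓ := hΓ) (hI := hI) (hL := hL) (hS := hS) (h𝔔₀ := h𝔔₀) (hv := hv) (lv := lv) (hlv := hlv) (Xbf := Xbf) (hXbf := hXbf) (H₁f := H₁f) (hH₁l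 := hH₁l) (Q₁₁f := Q₁₁f) (hQ₁₁l := hQ₁₁l) (Q₂₁f := Q₂₁f) (hQ₂₁l := hQ₂₁l) (H₂f := H₂f) (hH₂l := hH₂l) (hH₂r := hH₂r) (Q₁₂f := Q₁₂f) (hQ₁₂l := hQ₁₂l) (hQ₁₂r := hQ₁₂r) (Q₂₂f := Q₂₂f) (hQ₂₂l := hQ₂₂l) (hQ₂₂r := hQ₂₂r) (𝔔₁f := 𝔔₁f) (h𝔔₁ := h𝔔₁) (𝔔₂f := 𝔔₂f) (h𝔔₂ := h𝔔₂) (H'₁f := H'₁f) (hH'₁f := hH'₁f) (H'₂f := H'₂f) (hH'₂f := hH'₂f) (𝔔'₁f := 𝔔'₁f) (h𝔔'₁f := h𝔔'₁f) (𝔔'₂f := 𝔔'₂f) (h𝔔'₂f := h𝔔'₂f) (W₁f := W₁f) (W₂f := W₂f) (hW₁f := hW₁f) (hW₂f := hW₂f) (Db₁f := Db₁f) (Db₂f := Db₂f) (Y₁f := Y₁f) (Y₂f := Y₂f) (Gw₁f := Gw₁f) (hGw₁f := hGw₁f) (Gw₂f := Gw₂f) (hGw₂f := hGw₂f) (uTop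 := uTop) (hH₁t := hH₁t) (hH₂t := hH₂t) (a0 := a0) (d0 := d0) (a1 := a1) (a2 := a2) (c1 := c1) (c2 := c2) (d1 := d1) (d2 := d2) (hXN := hXN) (hXF := hXF) (dv := dv) (k := k) (l := l) (hXG := hXG')
  -- the G leg: unit transfer (#40a (U3)(U5)) + the displayed packed leg `hLG`
  rw [fromBlocks_one_units_eq_diagonal, fromBlocks_units_one_eq_diagonal, submatrix_diagonal_mul_mul_diagonal, sumElim_const_comp_map,
    sumElim_const_comp_map, hLG, hessT_unitConj (∏ i ∈ range (n + 1), wVH d Lc (lev i)) hw] at h41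
  -- ONE term of #39
  exact hessT_fullIndex_law_of_packed_law ρN LNc (towerTorus Lc M' (n + 1)) fN hfN hmN hcN hEAN hAEN _ hLN VN VN' WN hVNm hVNt hVN'm hVN't hWNm hWNt _ _ _ _ _ _
      hHN₁ hQN₁ hHN₁' hQN₁' hHN₂ hQN₂
    ρF LFc (towerTorus Lc M' (n + 1)) fF hfF hmF hcF hEAF hAEF _ hLF VF VF' WF hVFm hVFt hVF'm hVF't hWFm hWFt _ _ _ _ _ _ hHF₁ hQF₁ hHF₁' hQF₁' hHF₂ hQF₂
    ρG LGc M' fG hfG hmG hcG hEAG hAEG _ rfl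
      VG VG' WG hVGm hVGt hVG'm hVG't hWGm hWGt _ _ _ _ _ _ hHG₁ hQG₁ hHG₁' hQG₁' hHG₂ hQG₂ h41

end LawG

end Summit.QuantumFields.BalabanUV.Beta.FP.TowerLawFullIndexG

end
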